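import Summits.ABC.StewartYu.DescentLevelsThirdQ
import Summits.ABC.StewartYu.SiegelOnFinset
import HarnessLib

/-!
# Cell abc-stewartyu, W80Two (v): one step of the triadic (`q = 3`) descent and the endgame,
# sign-free

`Summits/ABC/StewartYu/DescentStepThirdQ.lean` — cell `abc-stewartyu` (HOME
`run/shared/lean/pub/abc-stewartyu/`, seat p2; route `PadicPrimesW80TwoThirds`, crux `W80Two`
stmt-ABC-19486), sequel to `DescentLevelsThirdQ.lean`; theorems only, no named fact.  The base-`3`
twin of p3's `DescentStepQ.lean` (`SetupQ.descent_algebra`, `SetupQ.coreSum_top_eq`,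
`SetupQ.w80_endgame`), PLACE-FREE:

* **`SetupQ.descent_algebra3`** — the algebraic half of the third step: from `Inv3` at level `J`
  and the vanishing of lit's triadic class sums `classVec3` (`DescentThirdQ.lean`) with the weights
  `c(u) = qΔ3_{J+1}(u,τ₀,s) · qA♭(u,τ')` at every `s < 3^{J+1} S₀`, `3 ∤ s`, `|τ| < T/3^{J+1}`, to
  `Inv3` at level `J + 1` (re-index the residue class of a non-zero coefficient by `λ = ε + 3μ`,
  pull out `3^{|τ'|} Kfac3`, recentre the binomials with `CW77.sum_mul_prod_pow_eq_zero_of_shift`);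
  in the `2`-adic proof the class sums are killed by lit's multicubic Liouville inequality
  (`MulticubLiouville.norm_ev3_ge_padic`) and the cube-Kummer separation
  (`SetupQ.classVec3_eq_zero_of_ev3_eq_zero`), so neither enters THIS file;
* `SetupQ.coreSum3_top_eq`, **`SetupQ.w80_endgame3`** — Waldschmidt's asymmetric endgame at the top
  level `L_θ < 3^{J₀}` on the points `{s < 3^{J₀} S₀ : 3 ∤ s}` (`Waldschmidt1980.endgame`, which
  only needs `αⱼ ≠ 0`);
* **`SetupQ.siegel3`** — Siegel's lemma at level `0` of the triadic descent (p3's set-up-free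
  `SiegelFinset.exists_int_vec_of_finset` on the whole box — at `p = 2` there is no class): given
  ABSTRACT denominators `Dc s τ > 0` clearing the coefficients `qTerm3_{0,τ}(u,s)` on the box and a
  bound `|Dc · qTerm3| ≤ Amax`, the count `2 · #eqs ≤ #box3₀` yields `Inv3` at `J = 0` with
  `P = ⌈#box3₀ · Amax⌉` (the concrete denominators and `Amax` are the parameter record's).

Everything is [folklore] book-keeping on [Yu1989, §3] / [CijsouwWaldschmidt1977, §4] /
[Waldschmidt1980, §3.5].

## References
* [Yu1989] K. Yu, *Linear forms in p-adic logarithms*, Acta Arith. 53 (1989), §3 (Lemma 3.5, the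
  main inductive argument).
* [CijsouwWaldschmidt1977] P. L. Cijsouw, M. Waldschmidt, Compositio Math. 34 (1977), §4 (pp. 189–191).
* [Waldschmidt1980] M. Waldschmidt, Acta Arith. 37 (1980), §3.5 (p. 274).
-/

noncomputable section

open Finset Polynomial
open Literature.NumberTheory.Transcendental
open Literature.NumberTheory.Transcendental.CW77
open Literature.NumberTheory.Transcendental.CW77.Setup (Idx Tau tauNorm tauSet mem_tauSet)
open Literature.NumberTheory.Transcendental.PadicCW77.Setup (DwQ)
open Literature.NumberTheory.Transcendental.Waldschmidt1980 (wScaled wPolyQ)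

namespace Summit.ABC.StewartYu

namespace SetupQ

variable (Q : SetupQ) {h Lb : ℕ}

/-! ### One step of the triadic descent: the algebra -/

/-- **The third step, algebraic half (place-free).** From the invariant at level `J` and the
vanishing of all triadic class sums `classVec3` with the weights `c(u) = qΔ3_{J+1}(u,τ₀,s) · qA♭(u,τ')`
(`s < 3^{J+1} S₀`, `3 ∤ s`, `|τ| < T/3^{J+1}`) to the invariant at level `J + 1`: choose `u₀` with
`p(u₀) ≠ 0`, let `(ε, ε_θ)` be its residues mod `3`, re-index the class of `u₀` by `λ = ε + 3μ`
(`p'(v) = p(ε + 3v)`), pull the constant `3^{|τ'|} Kfac3` out (`qEt_reidx3`, `qA_reidx3`), and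
recentre the binomials `(γⱼ + cⱼ)^{τ'ⱼ}` (`CW77.sum_mul_prod_pow_eq_zero_of_shift`).
[cite: Yu1989, §3 Lemma 3.5] [cite: CijsouwWaldschmidt1977, §4 Step 2 (pp. 189–191)] -/
theorem descent_algebra3 {J₀ J : ℕ} {L : Fin Q.d → ℕ} {Lθ S₀ T : ℕ} {P : ℤ}
    {p : Idx Q.d h Lb → ℤ} (inv : Q.Inv3 J₀ L Lθ S₀ T P J p)
    (third : ∀ s, s < 3 ^ (J + 1) * S₀ → ¬ 3 ∣ s → ∀ τ : Tau Q.d, tauNorm τ < T / 3 ^ (J + 1) →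
      Q.classVec3 (Q.box3 (h := h) (Lb := Lb) L Lθ J) p
        (fun u => Q.qΔ3 J₀ (J + 1) u τ.1 s * Q.flat.qA u τ.2) s = 0) :
    ∃ p' : Idx Q.d h Lb → ℤ, Q.Inv3 J₀ L Lθ S₀ T P (J + 1) p' := by
  classical
  obtain ⟨u₀, hu₀⟩ := inv.nonzero
  set ε : Fin Q.d → ℕ := fun j => u₀.2.1 j % 3 with hεdef
  set εθ : ℕ := u₀.2.2 % 3 with hεθdef
  have hε : ∀ j, ε j ≤ 2 := fun j => by simp only [hεdef]; omega
  have hεθ : εθ ≤ 2 := by simp only [hεθdef]; omega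
  set p' : Idx Q.d h Lb → ℤ := fun v => p (Q.reidx3 ε εθ v) with hp'
  set boxJ := Q.box3 (h := h) (Lb := Lb) L Lθ J with hboxJ
  set boxJ1 := Q.box3 (h := h) (Lb := Lb) L Lθ (J + 1) with hboxJ1
  refine ⟨p', ⟨?_, ?_, ?_, ?_⟩⟩
  · -- support
    intro v hv
    exact Q.mem_box3_succ_of_reidx3 (inv.supp _ hv)
  · -- not all zero
    refine ⟨Q.third u₀, ?_⟩
    simp only [hp']
    rw [Q.reidx3_third u₀ (fun j => rfl) rfl]
    exact hu₀
  · -- bound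
    intro v; exact inv.bound _
  · -- the relations at level `J + 1`
    intro s hs h3s τ hτ
    -- the class sums of the residue class `(ε, εθ)` vanish
    have hcv : ∀ τ' : Fin Q.d → ℕ, τ.1 + ∑ j, τ' j < T / 3 ^ (J + 1) →
        Q.classVec3 boxJ p (fun u => Q.qΔ3 J₀ (J + 1) u τ.1 s * Q.flat.qA u τ') s
          (Q.clsPat3 ε εθ s) = 0 := by
      intro τ' hτ'
      have h0 := third s hs h3s (τ.1, τ') (by unfold tauNorm; exact hτ')
      exact congrFun h0 _
    -- the set of new unknowns coming from old ones
    set Vs := boxJ1.filter fun v => Q.reidx3 ε εθ v ∈ boxJ with hVs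
    set W : Idx Q.d h Lb → ℚ := fun v => (p' v : ℚ) * (Q.qΔ3 J₀ (J + 1) v τ.1 s * Q.qE v s)
      with hW
    -- the shifted relations
    have hshift : ∀ τ' : Fin Q.d → ℕ, ∑ j, τ' j < T / 3 ^ (J + 1) - τ.1 →
        ∑ v ∈ Vs, W v * ∏ j, (Q.flat.γ v j + Q.cγ3 ε εθ j) ^ τ' j = 0 := by
      intro τ' hτ'
      have h1 := hcv τ' (by omega)
      unfold classVec3 at h1
      rw [Q.sum_class3_eq_sum_reidx3 h3s hε hεθ L Lθ J] at h1
      simp_rw [Q.qΔ3_reidx3, Q.qA_reidx3, Q.qEt_reidx3] at h1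
      have hK : (3 : ℚ) ^ (∑ j, τ' j) * Q.Kfac3 ε εθ s ≠ 0 :=
        mul_ne_zero (pow_ne_zero _ (by norm_num)) (Q.Kfac3_ne ε εθ s)
      have h2 : ∑ v ∈ Vs, (p (Q.reidx3 ε εθ v) : ℚ) *
          (Q.qΔ3 J₀ (J + 1) v τ.1 s * (3 ^ (∑ j, τ' j) * ∏ j, (Q.flat.γ v j + Q.cγ3 ε εθ j) ^ τ' j) *
            (Q.Kfac3 ε εθ s * Q.qE v s)) =
          ((3 : ℚ) ^ (∑ j, τ' j) * Q.Kfac3 ε εθ s) *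
            ∑ v ∈ Vs, W v * ∏ j, (Q.flat.γ v j + Q.cγ3 ε εθ j) ^ τ' j := by
        rw [mul_sum]
        refine sum_congr rfl fun v _ => ?_
        simp only [hW, hp']; ring
      rw [h2] at h1
      exact (mul_eq_zero.mp h1).resolve_left hK
    -- recentring
    have hrel := sum_mul_prod_pow_eq_zero_of_shift (d := Q.d) Vs W (fun v j => Q.flat.γ v j)
      (Q.cγ3 ε εθ) _ hshift τ.2 (by unfold tauNorm at hτ; omega)
    -- `coreSum3_{J+1} = ∑_{Vs} W ∏ γ^τ'`
    have hcore : Q.coreSum3 J₀ (J + 1) boxJ1 p' τ s = ∑ v ∈ Vs, W v * ∏ j, Q.flat.γ v j ^ τ.2 j := by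
      unfold coreSum3
      rw [hVs, sum_filter]
      refine sum_congr rfl fun v hv => ?_
      by_cases hvb : Q.reidx3 ε εθ v ∈ boxJ
      · rw [if_pos hvb]
        unfold qTerm3 CW77.Setup.qA
        simp only [hW]; ring
      · rw [if_neg hvb]
        have : p' v = 0 := by
          simp only [hp']
          by_contra hne
          exact hvb (inv.supp _ hne)
        rw [this]; simp
    rw [hcore]; exact hrel

/-! ### The top level: Waldschmidt's asymmetric endgame at base `3` -/

/-- **The signed rational core at the top level, as a double sum over `ρ` and the box
`∏ⱼ [0, ⌊Lⱼ/3^{J₀}⌋]`** (`L_θ < 3^{J₀}`, so `λ_θ = 0`, `γⱼ = λⱼ`):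
`coreSum3_{J₀,τ}(s) = τ₀! ∑_ρ ∑_λ p(ρ,λ,0) ((1/τ₀!)d^{τ₀}w_ρ)(s) ∏ⱼ (αⱼ^{sλⱼ} λⱼ^{τⱼ})`
(p3's `SetupQ.coreSum_top_eq` at base `3`). [cite: Waldschmidt1980, §3.5 (p. 274)] -/
theorem coreSum3_top_eq {L : Fin Q.d → ℕ} {Lθ J₀ : ℕ} (hLθ : Lθ < 3 ^ J₀)
    (p : Idx Q.d h Lb → ℤ) (τ : Tau Q.d) (s : ℕ) :
    Q.coreSum3 J₀ J₀ (Q.box3 (h := h) (Lb := Lb) L Lθ J₀) p τ s =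
      (τ.1.factorial : ℚ) * ∑ ρ : Fin h × Fin Lb, ∑ lam : ∀ j : Fin Q.d, Fin (L j / 3 ^ J₀ + 1),
        (p (ρ, (fun j => ((lam j : ℕ)), 0)) : ℚ) *
          (hasseDeriv τ.1 (wPolyQ (ρ.1 : ℕ) (ρ.2 : ℕ) h)).eval (s : ℚ) *
          ∏ j, ((Q.α j) ^ (s * (lam j : ℕ)) * (((lam j : ℕ) : ℚ)) ^ (τ.2 j)) := by
  classical
  unfold coreSum3 box3
  rw [Nat.div_eq_of_lt hLθ, zero_add, Finset.sum_product, Finset.mul_sum]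
  refine Finset.sum_congr rfl fun ρ _ => ?_
  rw [Finset.sum_product, Finset.mul_sum]
  simp only [Finset.sum_range_one]
  symm
  refine Finset.sum_bij' (fun lam _ => fun j => ((lam j : ℕ)))
    (fun μ hμ => fun j => ⟨μ j, mem_range.mp (Fintype.mem_piFinset.mp hμ j)⟩) ?_ ?_ ?_ ?_ ?_
  · intro lam _; exact Fintype.mem_piFinset.mpr fun j => mem_range.mpr (lam j).isLt
  · intro μ _; exact mem_univ _
  · intro lam _; rfl
  · intro μ _; rfl
  · intro lam _
    unfold qTerm3 CW77.Setup.qA CW77.Setup.γ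
    rw [Q.qΔ3_top_eq, Q.qE_of_zero]
    simp only [Nat.cast_zero, zero_mul, add_zero]
    rw [Finset.prod_mul_distrib]
    have hcomm : ∀ j : Fin Q.d, (Q.α j) ^ ((lam j : ℕ) * s) = (Q.α j) ^ (s * (lam j : ℕ)) := by
      intro j; rw [mul_comm]
    simp_rw [hcomm]
    ring

/-- **Waldschmidt 1980, §3.5 at base `3` — the contradiction at the top of the triadic descent.**
If the invariant holds at the level `J₀` where the range of the eliminated exponent is empty
(`L_θ < 3^{J₀}`), the derivative budget `⌊T/3^{J₀}⌋` covers `τ₀ < T'`, `τⱼ ≤ ⌊Lⱼ/3^{J₀}⌋`, and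
`h · Lb < T' · #{s < 3^{J₀} S₀ : 3 ∤ s}`, then all `p(u)` vanish — contradiction
(`Waldschmidt1980.endgame`, which needs only `αⱼ ≠ 0`). [cite: Waldschmidt1980, §3.5 (p. 274)]
[cite: Yu1989, §3] -/
theorem w80_endgame3 {J₀ : ℕ} {L : Fin Q.d → ℕ} {Lθ S₀ T : ℕ} {P : ℤ} {p : Idx Q.d h Lb → ℤ}
    (inv : Q.Inv3 J₀ L Lθ S₀ T P J₀ p) (hLθ : Lθ < 3 ^ J₀) {T' : ℕ}
    (hT' : T' + ∑ j, L j / 3 ^ J₀ ≤ T / 3 ^ J₀)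
    (hcount : h * Lb < T' * (Pts3 (3 ^ J₀ * S₀)).card) : False := by
  classical
  set L' : Fin Q.d → ℕ := fun j => L j / 3 ^ J₀ with hL'
  set boxJ := Q.box3 (h := h) (Lb := Lb) L Lθ J₀ with hboxJ
  set pts : Finset ℕ := Pts3 (3 ^ J₀ * S₀) with hpts
  set p' : (Fin h × Fin Lb) → (∀ j : Fin Q.d, Fin (L' j + 1)) → ℚ :=
    fun ρ lam => (p (ρ, (fun j => ((lam j : ℕ)), 0)) : ℚ) with hp'
  -- the vanishing in the form of `Waldschmidt1980.endgame`
  have hvan : ∀ s ∈ pts, ∀ k < T', ∀ τb : ∀ j : Fin Q.d, Fin (L' j + 1),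
      ∑ ρ : Fin h × Fin Lb, ∑ lam : ∀ j : Fin Q.d, Fin (L' j + 1),
        p' ρ lam * (hasseDeriv k (wPolyQ (ρ.1 : ℕ) (ρ.2 : ℕ) h)).eval ((fun n : ℕ => (n : ℚ)) s) *
          ∏ j, ((Q.α j) ^ (s * (lam j : ℕ)) * (((lam j : ℕ) : ℚ)) ^ ((τb j : ℕ))) = 0 := by
    intro s hs k hk τb
    rw [hpts, mem_Pts3] at hs
    set τ : Tau Q.d := (k, fun j => (τb j : ℕ)) with hτ
    have hτn : tauNorm τ < T / 3 ^ J₀ := by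
      show k + ∑ j, (τb j : ℕ) < T / 3 ^ J₀
      have hle : ∑ j, (τb j : ℕ) ≤ ∑ j, L' j :=
        Finset.sum_le_sum fun j _ => Nat.lt_succ_iff.mp (τb j).isLt
      have hT'' : T' + ∑ j, L' j ≤ T / 3 ^ J₀ := hT'
      omega
    have hrel := inv.rel s hs.1 hs.2 τ hτn
    rw [Q.coreSum3_top_eq hLθ p τ s] at hrel
    have hk0 : (k.factorial : ℚ) ≠ 0 := by exact_mod_cast (Nat.factorial_pos k).ne'
    have h0 := (mul_eq_zero.mp hrel).resolve_left hk0
    simpa [hp', hτ] using h0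
  have hend := Waldschmidt1980.endgame (K := ℚ)
    (fun ρ : Fin h × Fin Lb => wPolyQ (ρ.1 : ℕ) (ρ.2 : ℕ) h)
    (fun ρ => Waldschmidt1980.wPolyQ_ne_zero _ _ _) (CW77.Setup.injective_natDegree_wPolyQ h Lb)
    (N := h * Lb)
    (fun ρ => by
      rw [Waldschmidt1980.natDegree_wPolyQ]
      have h1 := ρ.1.isLt; have h2 := ρ.2.isLt
      have h3 : ((ρ.2 : ℕ) + 1) * h = (ρ.2 : ℕ) * h + h := by ring
      have h4 : ((ρ.2 : ℕ) + 1) * h ≤ Lb * h := Nat.mul_le_mul_right h h2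
      rw [mul_comm h Lb]; omega)
    L' (fun j => Q.α j) (fun j => Q.α_ne j) pts (fun n : ℕ => (n : ℚ))
    (fun a _ b _ hab => Nat.cast_injective (R := ℚ) hab) T' hcount p' hvan
  -- all `p(u)` vanish
  apply (inv.nonzero).elim
  intro u hu
  by_cases hmem : u ∈ boxJ
  · rw [Q.mem_box3_top_iff hLθ] at hmem
    obtain ⟨hμ, hθ⟩ := hmem
    have hlam : p' u.1 (fun j => ⟨u.2.1 j, Nat.lt_succ_of_le (hμ j)⟩) = 0 := by
      rw [hend]; rfl
    simp only [hp'] at hlam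
    have hu_eq : u = (u.1, (fun j => u.2.1 j, 0)) := by
      rcases u with ⟨ρ, μ, lθ⟩
      simp only at hθ ⊢
      rw [hθ]
    rw [hu_eq] at hu
    exact hu (by exact_mod_cast hlam)
  · exact hmem (inv.supp u hu)

/-! ### Level `0`: Siegel's lemma on the whole box -/

/-- **Siegel's lemma at level `0` of the triadic descent.** If the box of level `0` has at least
`2 · #eqs` unknowns, where `eqs = {(s, τ) : s < S₀, 3 ∤ s, |τ| < T}` (`2 ≤ S₀`, `1 ≤ T`), and some
positive integers `Dc(s,τ)` clear the signed coefficients `qTerm3_{0,τ}(u,s)` on the box with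
`|Dc(s,τ) · qTerm3| ≤ Amax` (`Amax ≥ 1`), then there are integers `p(u)`, not all zero, supported in the
box, bounded by `⌈#box3₀ · Amax⌉`, satisfying all relations of level `0`: the invariant `Inv3` at
`J = 0` (p3's `SiegelFinset.exists_int_vec_of_finset`). [cite: Yu1989, §3 Lemma 3.1]
[cite: Waldschmidt1980, Lemma 3.2 (pp. 266–267)] -/
theorem siegel3 (J₀ : ℕ) (L : Fin Q.d → ℕ) (Lθ S₀ T : ℕ) (hS₀ : 2 ≤ S₀) (hT : 1 ≤ T)
    (hcard : 2 * (Pts3 S₀ ×ˢ tauSet Q.d T).card ≤ (Q.box3 (h := h) (Lb := Lb) L Lθ 0).card)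
    (Dc : ℕ → Tau Q.d → ℕ) (hDc : ∀ s, s < S₀ → ¬ 3 ∣ s → ∀ τ : Tau Q.d, tauNorm τ < T → 0 < Dc s τ)
    (hint : ∀ s, s < S₀ → ¬ 3 ∣ s → ∀ τ : Tau Q.d, tauNorm τ < T →
      ∀ u ∈ Q.box3 (h := h) (Lb := Lb) L Lθ 0, ∃ z : ℤ, (Dc s τ : ℚ) * Q.qTerm3 J₀ 0 u τ s = z)
    {Amax : ℝ} (hAmax : 1 ≤ Amax)
    (hA : ∀ s, s < S₀ → ¬ 3 ∣ s → ∀ τ : Tau Q.d, tauNorm τ < T →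
      ∀ u ∈ Q.box3 (h := h) (Lb := Lb) L Lθ 0, |((Dc s τ : ℕ) : ℝ) * (Q.qTerm3 J₀ 0 u τ s : ℝ)| ≤ Amax) :
    ∃ p : Idx Q.d h Lb → ℤ,
      Q.Inv3 J₀ L Lθ S₀ T ⌈((Q.box3 (h := h) (Lb := Lb) L Lθ 0).card : ℝ) * Amax⌉ 0 p := by
  classical
  set boxZ := Q.box3 (h := h) (Lb := Lb) L Lθ 0 with hboxZ
  set eqs := Pts3 S₀ ×ˢ tauSet Q.d T with heqs
  have hE : eqs.Nonempty := by
    refine ⟨(1, ((0 : ℕ), (0 : Fin Q.d → ℕ))), ?_⟩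
    rw [heqs, mem_product, mem_Pts3, mem_tauSet]
    unfold tauNorm
    simp only [Pi.zero_apply, sum_const_zero, add_zero]
    omega
  obtain ⟨pv, hsupp, hne, hbd, hrel⟩ := SiegelFinset.exists_int_vec_of_finset boxZ eqs hE hcard
    (fun e u => Q.qTerm3 J₀ 0 u e.2 e.1) (fun e => Dc e.1 e.2)
    (fun e he => by
      rw [heqs, mem_product, mem_Pts3, mem_tauSet] at he
      exact hDc e.1 he.1.1 he.1.2 e.2 he.2)
    (fun e he u hu => by
      rw [heqs, mem_product, mem_Pts3, mem_tauSet] at he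
      exact hint e.1 he.1.1 he.1.2 e.2 he.2 u hu)
    hAmax
    (fun e he u hu => by
      rw [heqs, mem_product, mem_Pts3, mem_tauSet] at he
      have := hA e.1 he.1.1 he.1.2 e.2 he.2 u hu
      push_cast at this ⊢
      exact this)
  refine ⟨pv, ⟨hsupp, hne, hbd, ?_⟩⟩
  intro s hs h3 τ hτ
  rw [pow_zero, one_mul] at hs
  rw [pow_zero, Nat.div_one] at hτ
  have hmem : (s, τ) ∈ eqs := by
    rw [heqs, mem_product, mem_Pts3, mem_tauSet]; exact ⟨⟨hs, h3⟩, hτ⟩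
  exact hrel (s, τ) hmem

end SetupQ

end Summit.ABC.StewartYu

end
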